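import Mathlib.MeasureTheory.Measure.Haar.Basic
import Mathlib.MeasureTheory.Group.Action
import Literature.NumberTheory.Automorphic.SquareIntegrableCoefficientSummable
import Literature.NumberTheory.Automorphic.RankOneHeckeRecurrenceNotSquareSummable
import Literature.NumberTheory.Automorphic.HeckeEigencharacterPackage
import HarnessLib

/-!
# A `K`-spherical representation whose radius-one Hecke neighbours are distance-regular of type `(ab, b-1, 1)` with `a ≥ b`
# is NOT square-integrable modulo the centre (Macdonald 1971 Ch. V; Cartier 1979 §IV; Harish-Chandra 1970 Part I §1)

Topic `NumberTheory/Automorphic`; namespace `Literature.NumberTheory.Automorphic.SphericalCoefficient`.  THEOREMS ONLY; no definition,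
no named fact, no instance, no notation, no `sorry`.  Cell `hodgecm-mathlib`, fan-B row #79 (XP `Rogawski1990.XiPinSphericalCofinite`)
pay-down, road (B) «local», brick (L4β) = the junction of ★ `RankOneHeckeRecurrenceNotSquareSummable` (L3: no ℓ² radial eigenfunction) with ★
`SquareIntegrableCoefficientSummable` (L4α: square-integrability ⇒ ℓ² on disjoint shells; the spherical pair `(v₀, φ₀)`).  The structure theory
of the group enters ONLY through explicit hypotheses on `(G, K, t)` — Cartan shells `K tⁿ K` pairwise disjoint, their coset counts
`#(KtⁿK/K) = d_n`, and the DISTANCE-REGULARITY of the radius-one neighbours seen from `tⁿK` (`ab` of the `(a+1)b` cosets `tⁿ·xK`,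
`xK ⊆ KtK`, lie in `Kt^{n+1}K`, `b-1` in `KtⁿK`, `1` in `Kt^{n-1}K`) — which for the hyperspecial vertices of the unramified `U(3)`
(`a = q³`, `b = q`) are [BruhatTits1972 (4.4.3)–(4.4.4); Tits1979 §2.10, §3.3.3] and are supplied by the sequel bricks (L1)–(L2).
HC_CM is proved only modulo the printed citations until rung 0 closes; this file is unconditional and generic.

## What is formalised (`ω = c_{φ₀,v₀}` the zonal coefficient of ★ `exists_spherical_coefficient`)
* §1 `exists_heckeOperator_eq_smul` (a spherical line is an eigenline of `[KtK]`), **`sum_matrixCoeff_mul_eq`** (the Hecke relation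
  `Σ_{xK ⊆ KtK} ω(g x) = λ ω(g)`, ★ `heckeOperator_apply_eq_sum`).
* §2 **`radial_recurrence`** — distance-regular neighbours ⇒ the recurrence (R) of ★ `RankOneRadial.not_summable_norm_sq_mul_sphere`:
  `λ = (a+1)b ω(t)`, `λ ω(tⁿ) = ab ω(t^{n+1}) + (b-1) ω(tⁿ) + ω(t^{n-1})` (`n ≥ 1`).
* §3 the shells `S_n = K tⁿ K Z/Z ⊆ G⧸Z(G)` for `Z(G) ≤ K`: measurable, finite and PAIRWISE DISJOINT for a Haar measure, fibres inside `KtⁿK`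
  (`mem_doubleCoset_of_mk_mem_image`), and `μ(S_n) = #(KtⁿK/K) · μ(KZ/Z)` (`measure_image_doubleCoset_eq_card_mul`).
* §4 **`not_isSquareIntegrableModCenter_of_isSpherical`** — the junction: smooth `K`-spherical `ρ` + the hypotheses above with `b ≤ a`,
  `ab ≥ 2` ⇒ `¬ ρ.IsSquareIntegrableModCenter μ` for every Haar measure `μ` on `G ⧸ Z(G)`.
-/

noncomputable section

open MeasureTheory Filter Topology MulAction
open scoped Pointwise

namespace Literature.NumberTheory.Automorphic.SphericalCoefficient

/-! ## §1 The Hecke relation for the zonal coefficient -/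

section Hecke

variable {G V : Type*} [Group G] [AddCommGroup V] [Module ℂ V] {ρ : Representation ℂ G V} {K : Subgroup G}

/-- **A spherical line is an eigenline of every Hecke operator with finite double coset**: if `V^K = ℂ v₀` then `[KtK] v₀ = λ v₀` for some
`λ` (★ `heckeOperator_apply_mem_fixedPoints`). [cite: CartierCorvallis1979, §IV.1 Cor. 4.1] -/
theorem exists_heckeOperator_eq_smul (h1 : ρ.IsSpherical K) {v₀ : V} (hv₀ : v₀ ∈ ρ.fixedPoints K) (hv₀0 : v₀ ≠ 0) (t : G)
    (hfin : (orbit K (t : G ⧸ K)).Finite) : ∃ lam : ℂ, heckeOperator ρ K t v₀ = lam • v₀ := by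
  haveI : Module.Finite ℂ (ρ.fixedPoints K) := Module.finite_of_finrank_eq_succ h1
  have hne : (⟨v₀, hv₀⟩ : ρ.fixedPoints K) ≠ 0 := fun h => hv₀0 (congrArg Subtype.val h)
  obtain ⟨c, hc⟩ := (finrank_eq_one_iff_of_nonzero' (⟨v₀, hv₀⟩ : ρ.fixedPoints K) hne).1 h1
    ⟨heckeOperator ρ K t v₀, heckeOperator_apply_mem_fixedPoints ρ K t hv₀ hfin⟩
  exact ⟨c, by simpa using (congrArg Subtype.val hc).symm⟩

/-- **The Hecke relation for a coefficient of a `K`-fixed eigenvector**: if `[KtK] v₀ = λ v₀` and `X` is a transversal of `KtK/K`, then for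
every linear form `φ` and every `g`, `Σ_{x ∈ X} c_{φ,v₀}(g x) = λ · c_{φ,v₀}(g)` (apply `φ ∘ ρ(g)` to ★ `heckeOperator_apply_eq_sum`).
[cite: CartierCorvallis1979, §IV.1 Thm. 4.1] -/
theorem sum_matrixCoeff_mul_eq {v₀ : V} (hv₀ : v₀ ∈ ρ.fixedPoints K) {t : G} {X : Finset G}
    (hX : Set.BijOn (fun x : G => (x : G ⧸ K)) X (orbit K (t : G ⧸ K))) {lam : ℂ}
    (hlam : heckeOperator ρ K t v₀ = lam • v₀) (φ : Module.Dual ℂ V) (g : G) :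
    ∑ x ∈ X, ρ.matrixCoeff φ v₀ (g * x) = lam * ρ.matrixCoeff φ v₀ g := by
  have hsum : ∑ x ∈ X, ρ x v₀ = lam • v₀ := by rw [← heckeOperator_apply_eq_sum ρ K t X hX hv₀, hlam]
  have h := congrArg (fun w => φ (ρ g w)) hsum
  simp only [map_sum, map_smul, smul_eq_mul] at h
  simpa only [Representation.matrixCoeff_apply, map_mul, Module.End.mul_apply] using h

end Hecke

/-! ## §2 Distance-regular neighbours ⇒ the radial recurrence (R) -/

section Recurrence

variable {G V : Type*} [Group G] [AddCommGroup V] [Module ℂ V] {ρ : Representation ℂ G V} {K : Subgroup G}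

omit [Group G] in
/-- Sum of a function that is constant on a finset. [folklore] -/
private theorem sum_eq_card_mul_of_forall {X : Finset G} {f : G → ℂ} {c : ℂ} (h : ∀ x ∈ X, f x = c) :
    ∑ x ∈ X, f x = X.card * c := by
  rw [Finset.sum_congr rfl h, Finset.sum_const, nsmul_eq_mul]

/-- **The radial recurrence from distance-regular neighbours.**  Let `ω = c_{φ₀,v₀}` with `v₀ ∈ V^K`, `φ₀` `K`-invariant, `φ₀(v₀) = 1`, and
`Σ_{x∈X} ω(g x) = λ ω(g)` for a transversal `X` of `KtK/K` with `#X = (a+1)b`.  If for every `n ≥ 1` the cosets `tⁿ x K` (`x ∈ X`) are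
distributed over the (pairwise disjoint) shells `K t^{n+1} K`, `K tⁿ K`, `K t^{n-1} K` with counts `ab`, `b-1`, `1`, then `ω_n := ω(tⁿ)` satisfies
`ω₀ = 1`, `λ = (a+1)b ω₁`, `λ ω_n = ab ω_{n+1} + (b-1) ω_n + ω_{n-1}` (`n ≥ 1`) — the hypotheses of ★ `RankOneRadial.not_summable_norm_sq_mul_sphere`.
[cite: Macdonald1971, Ch. V §3] [cite: CartierCorvallis1979, §IV.1 Thm. 4.1] -/
theorem radial_recurrence {a b : ℕ} {v₀ : V} (hv₀ : v₀ ∈ ρ.fixedPoints K) {φ₀ : Module.Dual ℂ V}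
    (hφ₀ : ∀ κ ∈ K, ∀ w : V, φ₀ (ρ κ w) = φ₀ w) (hφv : φ₀ v₀ = 1) {t : G} {X : Finset G}
    (hX1 : ∀ x ∈ X, x ∈ DoubleCoset.doubleCoset t (K : Set G) K) (hcard : X.card = (a + 1) * b) {lam : ℂ}
    (hH : ∀ g : G, ∑ x ∈ X, ρ.matrixCoeff φ₀ v₀ (g * x) = lam * ρ.matrixCoeff φ₀ v₀ g)
    (hD : ∀ m n : ℕ, m ≠ n → Disjoint (DoubleCoset.doubleCoset (t ^ m) (K : Set G) K) (DoubleCoset.doubleCoset (t ^ n) (K : Set G) K))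
    (hreg : ∀ n, 1 ≤ n →
      {x | x ∈ X ∧ t ^ n * x ∈ DoubleCoset.doubleCoset (t ^ (n + 1)) (K : Set G) K}.ncard = a * b ∧
      {x | x ∈ X ∧ t ^ n * x ∈ DoubleCoset.doubleCoset (t ^ n) (K : Set G) K}.ncard = b - 1 ∧
      {x | x ∈ X ∧ t ^ n * x ∈ DoubleCoset.doubleCoset (t ^ (n - 1)) (K : Set G) K}.ncard = 1 ∧
      ∀ x ∈ X, t ^ n * x ∈ DoubleCoset.doubleCoset (t ^ (n + 1)) (K : Set G) K ∨
        t ^ n * x ∈ DoubleCoset.doubleCoset (t ^ n) (K : Set G) K ∨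
        t ^ n * x ∈ DoubleCoset.doubleCoset (t ^ (n - 1)) (K : Set G) K) (hb : 1 ≤ b) :
    ρ.matrixCoeff φ₀ v₀ (t ^ 0) = 1 ∧ lam = (a + 1) * b * ρ.matrixCoeff φ₀ v₀ (t ^ 1) ∧
      ∀ n, 1 ≤ n → lam * ρ.matrixCoeff φ₀ v₀ (t ^ n) =
        a * b * ρ.matrixCoeff φ₀ v₀ (t ^ (n + 1)) + (b - 1) * ρ.matrixCoeff φ₀ v₀ (t ^ n) + ρ.matrixCoeff φ₀ v₀ (t ^ (n - 1)) := by
  set ω : G → ℂ := ρ.matrixCoeff φ₀ v₀ with hω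
  have hω1 : ω 1 = 1 := matrixCoeff_one_eq_one hφv
  refine ⟨by rw [pow_zero, hω1], ?_, fun n hn => ?_⟩
  · -- `g = 1`: every `x ∈ X` lies in `KtK`, so `ω x = ω t`
    have h := hH 1
    simp only [one_mul, hω1, mul_one] at h
    rw [← h, pow_one, sum_eq_card_mul_of_forall (c := ω t) (fun x hx => matrixCoeff_eq_of_mem_doubleCoset hv₀ hφ₀ (hX1 x hx)),
      hcard]
    push_cast; ring
  · obtain ⟨hp, hz, hm, hcov⟩ := hreg n hn
    -- abbreviations for the three membership predicates
    set P : G → Prop := fun x => t ^ n * x ∈ DoubleCoset.doubleCoset (t ^ (n + 1)) (K : Set G) K with hP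
    set Q : G → Prop := fun x => t ^ n * x ∈ DoubleCoset.doubleCoset (t ^ n) (K : Set G) K with hQ
    set R : G → Prop := fun x => t ^ n * x ∈ DoubleCoset.doubleCoset (t ^ (n - 1)) (K : Set G) K with hR
    have hPQ : ∀ x, P x → ¬ Q x := fun x h1 h2 =>
      Set.disjoint_left.1 (hD (n + 1) n (by omega)) h1 h2
    have hPR : ∀ x, P x → ¬ R x := fun x h1 h2 =>
      Set.disjoint_left.1 (hD (n + 1) (n - 1) (by omega)) h1 h2
    have hQR : ∀ x, Q x → ¬ R x := fun x h1 h2 =>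
      Set.disjoint_left.1 (hD n (n - 1) (by omega)) h1 h2
    have h := hH (t ^ n)
    rw [← h]
    classical
    have hncard : ∀ (S : G → Prop) [DecidablePred S] (m : ℕ), {x | x ∈ X ∧ S x}.ncard = m → (X.filter S).card = m := by
      intro S _ m hm
      rw [← hm, ← Set.ncard_coe_finset, Finset.coe_filter]
    have hp' := hncard P _ hp
    have hz' := hncard Q _ hz
    have hm' := hncard R _ hm
    -- split the sum along `P`, then `Q`; the remainder is `R`
    rw [← Finset.sum_filter_add_sum_filter_not X P, ← Finset.sum_filter_add_sum_filter_not (X.filter fun x => ¬ P x) Q]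
    have hQ' : (X.filter fun x => ¬ P x).filter Q = X.filter Q := by
      ext x; simp only [Finset.mem_filter]; exact ⟨fun h => ⟨h.1.1, h.2⟩, fun h => ⟨⟨h.1, fun hp' => hPQ x hp' h.2⟩, h.2⟩⟩
    have hR' : (X.filter fun x => ¬ P x).filter (fun x => ¬ Q x) = X.filter R := by
      ext x; simp only [Finset.mem_filter]
      refine ⟨fun h => ⟨h.1.1, ?_⟩, fun h => ⟨⟨h.1, fun hp' => hPR x hp' h.2⟩, fun hq' => hQR x hq' h.2⟩⟩
      rcases hcov x h.1.1 with h' | h' | h'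
      · exact absurd h' h.1.2
      · exact absurd h' h.2
      · exact h'
    rw [hQ', hR',
      sum_eq_card_mul_of_forall (c := ω (t ^ (n + 1))) (fun x hx => matrixCoeff_eq_of_mem_doubleCoset hv₀ hφ₀ (Finset.mem_filter.1 hx).2),
      sum_eq_card_mul_of_forall (c := ω (t ^ n)) (fun x hx => matrixCoeff_eq_of_mem_doubleCoset hv₀ hφ₀ (Finset.mem_filter.1 hx).2),
      sum_eq_card_mul_of_forall (c := ω (t ^ (n - 1))) (fun x hx => matrixCoeff_eq_of_mem_doubleCoset hv₀ hφ₀ (Finset.mem_filter.1 hx).2),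
      hp', hz', hm']
    push_cast [Nat.cast_sub hb]
    ring

end Recurrence

/-! ## §3 The Cartan shells in `G ⧸ Z(G)` -/

section Shells

variable {G : Type*} [Group G] {K : Subgroup G}

/-- If `Z(G) ≤ K`, a double coset `K s K` is saturated for `G → G⧸Z(G)`: `g₁ ∈ KsK` and `g₁ Z = g₂ Z` imply `g₂ ∈ KsK`
(functions on `G` constant on `Z(G)`-cosets, as in Harish-Chandra's `∫_{G/Z}`). [cite: HarishChandra1970, Part I §1 p. 4] -/
theorem mem_doubleCoset_of_mk_eq (hZK : Subgroup.center G ≤ K) {s g₁ g₂ : G} (h₁ : g₁ ∈ DoubleCoset.doubleCoset s (K : Set G) K)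
    (h : (g₁ : G ⧸ Subgroup.center G) = g₂) : g₂ ∈ DoubleCoset.doubleCoset s (K : Set G) K := by
  have hz : g₁⁻¹ * g₂ ∈ K := hZK (QuotientGroup.eq.1 h)
  obtain ⟨k₁, hk₁, k₂, hk₂, rfl⟩ := DoubleCoset.mem_doubleCoset.1 h₁
  refine DoubleCoset.mem_doubleCoset.2 ⟨k₁, hk₁, k₂ * ((k₁ * s * k₂)⁻¹ * g₂), K.mul_mem hk₂ hz, ?_⟩
  group

/-- Fibres of the shell: `gZ ∈ (KsK)Z/Z ⇒ g ∈ KsK` (for `Z(G) ≤ K`). [cite: HarishChandra1970, Part I §1 p. 4] -/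
theorem mem_doubleCoset_of_mk_mem_image (hZK : Subgroup.center G ≤ K) {s g : G}
    (h : (g : G ⧸ Subgroup.center G) ∈ (QuotientGroup.mk : G → G ⧸ Subgroup.center G) '' DoubleCoset.doubleCoset s (K : Set G) K) :
    g ∈ DoubleCoset.doubleCoset s (K : Set G) K := by
  obtain ⟨g₁, h₁, h⟩ := h
  exact mem_doubleCoset_of_mk_eq hZK h₁ h

/-- Disjoint double cosets have disjoint shells in `G ⧸ Z(G)` (for `Z(G) ≤ K`). [cite: HarishChandra1970, Part I §1 p. 4] -/
theorem disjoint_image_doubleCoset (hZK : Subgroup.center G ≤ K) {s s' : G}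
    (h : Disjoint (DoubleCoset.doubleCoset s (K : Set G) K) (DoubleCoset.doubleCoset s' (K : Set G) K)) :
    Disjoint ((QuotientGroup.mk : G → G ⧸ Subgroup.center G) '' DoubleCoset.doubleCoset s (K : Set G) K)
      ((QuotientGroup.mk : G → G ⧸ Subgroup.center G) '' DoubleCoset.doubleCoset s' (K : Set G) K) := by
  rw [Set.disjoint_left]
  rintro _ ⟨g₁, h₁, rfl⟩ h₂
  exact Set.disjoint_left.1 h h₁ (mem_doubleCoset_of_mk_mem_image hZK h₂)

/-- A left coset `xK` maps onto the translate `xZ · (KZ/Z)` in `G ⧸ Z(G)`. [cite: CartierCorvallis1979, §IV.1] -/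
theorem image_mk_smul_coe (x : G) :
    (QuotientGroup.mk : G → G ⧸ Subgroup.center G) '' (x • (K : Set G)) =
      (x : G ⧸ Subgroup.center G) • ((QuotientGroup.mk : G → G ⧸ Subgroup.center G) '' (K : Set G)) := by
  ext y
  simp only [Set.mem_image, Set.mem_smul_set, smul_eq_mul]
  constructor
  · rintro ⟨_, ⟨k, hk, rfl⟩, rfl⟩
    exact ⟨(k : G ⧸ Subgroup.center G), ⟨k, hk, rfl⟩, (QuotientGroup.mk_mul _ x k).symm⟩
  · rintro ⟨_, ⟨k, hk, rfl⟩, rfl⟩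
    exact ⟨x * k, ⟨k, hk, rfl⟩, QuotientGroup.mk_mul _ x k⟩

/-- A double coset is the union of the left cosets of a transversal: `KsK = ⋃_{x ∈ X} xK` («`ind(KgK)` cosets»). [cite: CartierCorvallis1979, §IV.1] -/
theorem doubleCoset_eq_biUnion_smul {s : G} {X : Finset G} (hX : Set.BijOn (fun x : G => (x : G ⧸ K)) X (orbit K (s : G ⧸ K))) :
    DoubleCoset.doubleCoset s (K : Set G) K = ⋃ x ∈ X, x • (K : Set G) := by
  ext g
  rw [mem_doubleCoset_iff_mk_mem_orbit, Set.mem_iUnion₂]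
  constructor
  · intro hg
    obtain ⟨x, hx, hxg⟩ := hX.surjOn hg
    refine ⟨x, hx, ?_⟩
    rw [Set.mem_smul_set]
    refine ⟨x⁻¹ * g, ?_, by simp⟩
    exact QuotientGroup.eq.1 hxg
  · rintro ⟨x, hx, hg⟩
    obtain ⟨k, hk, rfl⟩ := Set.mem_smul_set.1 hg
    have : ((x • k : G) : G ⧸ K) = (x : G ⧸ K) := by
      rw [smul_eq_mul, QuotientGroup.eq]; simpa using K.inv_mem hk
    rw [this]; exact hX.mapsTo hx

/-- Distinct members of a transversal of `KsK/K` give DISJOINT translates `xZ·(KZ/Z)` (for `Z(G) ≤ K`). [cite: CartierCorvallis1979, §IV.1] -/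
theorem disjoint_image_smul_of_ne (hZK : Subgroup.center G ≤ K) {x y : G} (hxy : (x : G ⧸ K) ≠ (y : G ⧸ K)) :
    Disjoint ((QuotientGroup.mk : G → G ⧸ Subgroup.center G) '' (x • (K : Set G)))
      ((QuotientGroup.mk : G → G ⧸ Subgroup.center G) '' (y • (K : Set G))) := by
  rw [Set.disjoint_left]
  rintro _ ⟨g₁, hg₁, rfl⟩ ⟨g₂, hg₂, h⟩
  obtain ⟨k₁, hk₁, rfl⟩ := Set.mem_smul_set.1 hg₁
  obtain ⟨k₂, hk₂, rfl⟩ := Set.mem_smul_set.1 hg₂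
  have hz : (y • k₂)⁻¹ * (x • k₁) ∈ K := hZK (QuotientGroup.eq.1 h)
  apply hxy
  rw [QuotientGroup.eq]
  have : x⁻¹ * y = k₁ * ((y • k₂)⁻¹ * (x • k₁))⁻¹ * k₂⁻¹ := by simp only [smul_eq_mul]; group
  rw [this]
  exact K.mul_mem (K.mul_mem hk₁ (K.inv_mem hz)) (K.inv_mem hk₂)

variable [TopologicalSpace G] [IsTopologicalGroup G]

/-- The shell `(KsK)Z/Z` is open for `K` open. [cite: CartierCorvallis1979, §IV.1] -/
theorem isOpen_image_doubleCoset (hKo : IsOpen (K : Set G)) (s : G) :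
    IsOpen ((QuotientGroup.mk : G → G ⧸ Subgroup.center G) '' DoubleCoset.doubleCoset s (K : Set G) K) :=
  QuotientGroup.isOpenMap_coe _ hKo.mul_left

/-- The shell `(KsK)Z/Z` is compact for `K` compact. [cite: CartierCorvallis1979, §IV.1] -/
theorem isCompact_image_doubleCoset (hKc : IsCompact (K : Set G)) (s : G) :
    IsCompact ((QuotientGroup.mk : G → G ⧸ Subgroup.center G) '' DoubleCoset.doubleCoset s (K : Set G) K) :=
  ((hKc.mul isCompact_singleton).mul hKc).image continuous_quot_mk

variable [MeasurableSpace (G ⧸ Subgroup.center G)] [BorelSpace (G ⧸ Subgroup.center G)]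

/-- **Measure of a shell**: for `Z(G) ≤ K` and a left-invariant measure `μ` on `G ⧸ Z(G)`, `μ((KsK)Z/Z) = #(KsK/K) · μ(KZ/Z)`.
[cite: CartierCorvallis1979, §IV.1] -/
theorem measure_image_doubleCoset_eq_card_mul (hZK : Subgroup.center G ≤ K) (hKo : IsOpen (K : Set G))
    (μ : Measure (G ⧸ Subgroup.center G)) [μ.IsMulLeftInvariant] {s : G} {X : Finset G}
    (hX : Set.BijOn (fun x : G => (x : G ⧸ K)) X (orbit K (s : G ⧸ K))) :
    μ ((QuotientGroup.mk : G → G ⧸ Subgroup.center G) '' DoubleCoset.doubleCoset s (K : Set G) K) =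
      X.card * μ ((QuotientGroup.mk : G → G ⧸ Subgroup.center G) '' (K : Set G)) := by
  classical
  rw [doubleCoset_eq_biUnion_smul hX, Set.image_iUnion₂, measure_biUnion_finset]
  · simp_rw [image_mk_smul_coe, measure_smul]
    rw [Finset.sum_const, nsmul_eq_mul]
  · intro x hx y hy hxy
    exact disjoint_image_smul_of_ne hZK (fun h => hxy (hX.injOn hx hy h))
  · intro x _
    rw [image_mk_smul_coe]
    exact ((QuotientGroup.isOpenMap_coe _ hKo).smul _).measurableSet

end Shells

/-! ## §4 The junction: hyperspecial-spherical ⇒ not square-integrable modulo the centre -/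

section Main

variable {G V : Type*} [Group G] [TopologicalSpace G] [IsTopologicalGroup G] [AddCommGroup V] [Module ℂ V]
  [MeasurableSpace (G ⧸ Subgroup.center G)] [BorelSpace (G ⧸ Subgroup.center G)]
  {ρ : Representation ℂ G V} {K : Subgroup G}

/-- **A `K`-spherical smooth representation with distance-regular radius-one Hecke neighbours of type `(ab, b-1, 1)`, `b ≤ a`, `ab ≥ 2`, is not
square-integrable modulo the centre.**  Hypotheses on `(G, K, t)`: `K` compact open containing `Z(G)`; the Cartan shells `K tⁿ K` (`n ∈ ℕ`)
pairwise disjoint with transversals `X_n` of `KtⁿK/K` of size `d₀ = 1`, `d_n = (a+1)b(ab)^{n-1}`; and for `n ≥ 1` the `(a+1)b` neighbours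
`tⁿ x K` (`x ∈ X_1`) of `tⁿK` split as `ab` in `Kt^{n+1}K`, `b-1` in `KtⁿK`, `1` in `Kt^{n-1}K`.  For the unramified `U(3)` and its hyperspecial
`K = U(3)(𝒪)` these hold with `a = q³`, `b = q` (the `(q³+1, q+1)`-semi-homogeneous Bruhat–Tits tree); the conclusion is «no `K`-spherical
representation of `U(3)` is square-integrable», in particular the spherical constituent of a reducible unramified principal series is the
non-square-integrable one.  Proof: the zonal coefficient `ω` (★ `exists_spherical_coefficient`) satisfies the recurrence (R) (`radial_recurrence`),
so `Σ |ω(tⁿ)|² d_n = ∞` (★ `RankOneRadial.not_summable_norm_sq_mul_sphere`), while square-integrability gives `Σ |ω(tⁿ)|² μ(KtⁿKZ/Z) < ∞`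
(★ `summable_sq_mul_measureReal`) with `μ(KtⁿKZ/Z) = d_n μ(KZ/Z)`, `μ(KZ/Z) > 0`.
[cite: Macdonald1971, Ch. V §3] [cite: HarishChandra1970, Part I §1 p. 4] [cite: CartierCorvallis1979, §IV.1 Thm. 4.2] -/
theorem not_isSquareIntegrableModCenter_of_isSpherical {a b : ℕ} (hba : b ≤ a) (hab : 2 ≤ a * b)
    (hKo : IsOpen (K : Set G)) (hKc : IsCompact (K : Set G)) (hZK : Subgroup.center G ≤ K) {t : G}
    (hD : ∀ m n : ℕ, m ≠ n → Disjoint (DoubleCoset.doubleCoset (t ^ m) (K : Set G) K) (DoubleCoset.doubleCoset (t ^ n) (K : Set G) K))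
    {X : ℕ → Finset G} (hX : ∀ n, Set.BijOn (fun x : G => (x : G ⧸ K)) (X n) (orbit K ((t ^ n : G) : G ⧸ K)))
    (hcard : ∀ n, ((X n).card : ℝ) = if n = 0 then (1 : ℝ) else ((a : ℝ) + 1) * b * ((a : ℝ) * b) ^ (n - 1))
    (hreg : ∀ n, 1 ≤ n →
      {x | x ∈ X 1 ∧ t ^ n * x ∈ DoubleCoset.doubleCoset (t ^ (n + 1)) (K : Set G) K}.ncard = a * b ∧
      {x | x ∈ X 1 ∧ t ^ n * x ∈ DoubleCoset.doubleCoset (t ^ n) (K : Set G) K}.ncard = b - 1 ∧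
      {x | x ∈ X 1 ∧ t ^ n * x ∈ DoubleCoset.doubleCoset (t ^ (n - 1)) (K : Set G) K}.ncard = 1 ∧
      ∀ x ∈ X 1, t ^ n * x ∈ DoubleCoset.doubleCoset (t ^ (n + 1)) (K : Set G) K ∨
        t ^ n * x ∈ DoubleCoset.doubleCoset (t ^ n) (K : Set G) K ∨
        t ^ n * x ∈ DoubleCoset.doubleCoset (t ^ (n - 1)) (K : Set G) K)
    (hρ : ρ.IsSmooth) (h1 : ρ.IsSpherical K) (μ : Measure (G ⧸ Subgroup.center G)) [μ.IsHaarMeasure] :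
    ¬ ρ.IsSquareIntegrableModCenter μ := by
  intro hSI
  have hb : 1 ≤ b := by
    rcases Nat.eq_zero_or_pos b with h | h
    · subst h; simp at hab
    · exact h
  -- the spherical pair and its zonal coefficient
  obtain ⟨v₀, hv₀, hv₀0, φ₀, hφ₀c, hφv, hφ₀⟩ := exists_spherical_coefficient hρ hKc hKo h1
  -- the eigenvalue of `[KtK]` on `v₀`
  have hfin : (orbit K (t : G ⧸ K)).Finite := by
    simpa using (Set.Finite.image _ (X 1).finite_toSet).subset (hX 1).surjOn
  have hfin' : (orbit K (t : G ⧸ K)).Finite := by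
    haveI := isHeckeTriple_top_of_isCompact_isOpen K hKc hKo
    exact finite_orbit_quotient K t
  obtain ⟨lam, hlam⟩ := exists_heckeOperator_eq_smul h1 hv₀ hv₀0 t hfin'
  have hX1 : Set.BijOn (fun x : G => (x : G ⧸ K)) (X 1) (orbit K (t : G ⧸ K)) := by simpa using hX 1
  have hH := sum_matrixCoeff_mul_eq hv₀ hX1 hlam φ₀
  have hX1mem : ∀ x ∈ X 1, x ∈ DoubleCoset.doubleCoset t (K : Set G) K := fun x hx =>
    (mem_doubleCoset_iff_mk_mem_orbit t x).2 (hX1.mapsTo hx)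
  have hcard1 : (X 1).card = (a + 1) * b := by
    have h := hcard 1
    simp only [one_ne_zero, if_false, Nat.sub_self, pow_zero, mul_one] at h
    exact_mod_cast h
  -- the recurrence (R)
  obtain ⟨h0, hl, hrec⟩ := radial_recurrence hv₀ hφ₀ hφv hX1mem hcard1 hH hD hreg hb
  -- hence no square-summability against the sphere sizes
  have hns := RankOneRadial.not_summable_norm_sq_mul_sphere (ω := fun n => ρ.matrixCoeff φ₀ v₀ (t ^ n)) hba hab
    (by simpa using h0) hl hrec
  apply hns
  -- square-integrability gives square-summability on the shells `S_n = K tⁿ K Z / Z`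
  set π : G → G ⧸ Subgroup.center G := QuotientGroup.mk with hπ
  set S : ℕ → Set (G ⧸ Subgroup.center G) := fun n => π '' DoubleCoset.doubleCoset (t ^ n) (K : Set G) K with hS
  have hSm : ∀ n, MeasurableSet (S n) := fun n => (isOpen_image_doubleCoset hKo (t ^ n)).measurableSet
  have hSfin : ∀ n, μ (S n) < ⊤ := fun n => (isCompact_image_doubleCoset hKc (t ^ n)).measure_lt_top (μ := μ)
  have hSdisj : Pairwise (Function.onFun Disjoint S) := fun m n hmn => disjoint_image_doubleCoset hZK (hD m n hmn)
  have hc : ∀ n (g : G), (g : G ⧸ Subgroup.center G) ∈ S n →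
      ‖ρ.matrixCoeff φ₀ v₀ (t ^ n)‖ ≤ ‖ρ.matrixCoeff φ₀ v₀ g‖ := fun n g hg =>
    (congrArg _ (matrixCoeff_eq_of_mem_doubleCoset hv₀ hφ₀ (mem_doubleCoset_of_mk_mem_image hZK hg)).symm).le
  have hsum := summable_sq_mul_measureReal hSI hφ₀c v₀ hSm hSfin hSdisj (fun n => norm_nonneg _) hc
  -- `μ(S_n) = d_n · μ(KZ/Z)` with `0 < μ(KZ/Z) < ∞`
  have hKc' : IsCompact (π '' (K : Set G)) := hKc.image continuous_quot_mk
  have hK0 : 0 < μ.real (π '' (K : Set G)) :=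
    ENNReal.toReal_pos ((QuotientGroup.isOpenMap_coe _ hKo).measure_pos μ ⟨π 1, 1, K.one_mem, rfl⟩).ne'
      (hKc'.measure_lt_top (μ := μ)).ne
  have hSn : ∀ n, μ.real (S n) = (X n).card * μ.real (π '' (K : Set G)) := by
    intro n
    simp only [hS, Measure.real]
    rw [measure_image_doubleCoset_eq_card_mul hZK hKo μ (hX n), ENNReal.toReal_mul, ENNReal.toReal_natCast]
  have heq : (fun n => ‖ρ.matrixCoeff φ₀ v₀ (t ^ n)‖ ^ 2 *
      (if n = 0 then (1 : ℝ) else ((a : ℝ) + 1) * b * ((a : ℝ) * b) ^ (n - 1))) =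
      fun n => (μ.real (π '' (K : Set G)))⁻¹ * (‖ρ.matrixCoeff φ₀ v₀ (t ^ n)‖ ^ 2 * μ.real (S n)) := by
    funext n
    rw [hSn n, hcard n]
    field_simp
  rw [heq]
  exact hsum.mul_left _

end Main

end Literature.NumberTheory.Automorphic.SphericalCoefficient

end
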